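import Summits.CriticalPhenomena.CardyFormulaZ2.Theorems.CardyUSTContinuationKirchhoffExtremalLengthRectangle

/-!
# The reciprocal extremal distance of a conformal rectangle as a function of the cross-ratio
# (part 2 of 2)

Support file for `KirchhoffExtremalLength` (route CardyUSTContinuation of `CardyFormulaZ2`,
item stmt-CriticalPhenomena-11234), continuum side of conjunct 2: for every conformal rectangle
`R = (Ω; a, b, c, d)` and every uniformizing datum `(φ, x)`,

  `d_Ω((ab), (cd))⁻¹ = ₂F₁(½,½;1;η) / ₂F₁(½,½;1;1-η)`,   `η = crossRatio x`

(`toReal_inv_extremalDistance_arc_eq`). This part: the closed vertical sides of the uniformizing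
rectangle of `…Rectangle.lean` go ONTO the arcs `0`, `2` (`image_sides_eq`), hence by conformal
invariance (`extremalDistance_image_eq`) and `extremalDistance_rectangle` the extremal distance
of the arcs is the aspect ratio `2K(k²)/K(1-k²)` (`extremalDistance_arc_eq`), whose reciprocal is
the hypergeometric ratio at the cross-ratio (`hypergeometric_ratio_eq` of part 1).
-/

noncomputable section

namespace Summit.CriticalPhenomena.CardyFormulaZ2.Theorems

namespace ModulusIdentification

open Set Filter Topology Complex Metric
open Literature.Probability.RandomPlanarGeometry Literature.Probability.LatticeModels
open Literature.Probability.LatticeModels.SquareTiling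
open UpperHalfPlane (upperHalfPlaneSet)

/-! ### §4. The vertical sides go ONTO the arcs; the extremal distance of the arcs -/

/-- **The closed vertical sides of a uniformizing rectangle are mapped onto the two arcs.** With
the data of `exists_rect_uniformizer` (continuous injection of `[0,a]×[0,b]` onto `closure Ω`
taking the open rectangle onto `Ω`, closed vertical sides into the arcs `jL`, `jR`
(`{jL, jR} = {0, 2}`), open horizontal sides into the open arcs `1`, `3`): a point of `arc jL` is
the image of a point of the closed rectangle, which is neither interior (`Ω ∩ ∂Ω = ∅`), nor on
the right side (`arc 0 ∩ arc 2 = ∅`), nor on an open horizontal side (open arcs `1`, `3` miss the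
arcs `0`, `2`). [folklore] -/
theorem image_sides_eq (R : ConformalRectangle) {a b : ℝ} {Ψ : ℂ → ℂ}
    {jL jR : Fin 4} (himg : Ψ '' (Icc 0 a ×ℂ Icc 0 b) = closure R.carrier)
    (himgo : Ψ '' (Ioo 0 a ×ℂ Ioo 0 b) = R.carrier) (hLR : (jL = 0 ∧ jR = 2) ∨ (jL = 2 ∧ jR = 0))
    (hL : Ψ '' ({0} ×ℂ Icc 0 b) ⊆ R.arc jL) (hR : Ψ '' ({a} ×ℂ Icc 0 b) ⊆ R.arc jR)
    (hB : Ψ '' (Ioo 0 a ×ℂ {0}) ⊆ openArc R 1) (hT : Ψ '' (Ioo 0 a ×ℂ {b}) ⊆ openArc R 3) :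
    Ψ '' ({0} ×ℂ Icc 0 b) = R.arc jL ∧ Ψ '' ({a} ×ℂ Icc 0 b) = R.arc jR := by
  have hdisj02 : Disjoint (R.arc jL) (R.arc jR) := by
    rcases hLR with ⟨rfl, rfl⟩ | ⟨rfl, rfl⟩
    · exact R.disjoint_arc_zero_arc_two
    · exact R.disjoint_arc_zero_arc_two.symm
  have hjL1 : jL ≠ 1 := by rcases hLR with ⟨rfl, -⟩ | ⟨rfl, -⟩ <;> decide
  have hjL3 : jL ≠ 3 := by rcases hLR with ⟨rfl, -⟩ | ⟨rfl, -⟩ <;> decide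
  have hjR1 : jR ≠ 1 := by rcases hLR with ⟨-, rfl⟩ | ⟨-, rfl⟩ <;> decide
  have hjR3 : jR ≠ 3 := by rcases hLR with ⟨-, rfl⟩ | ⟨-, rfl⟩ <;> decide
  -- a frontier point is the image of a non-interior point of the closed rectangle
  have key : ∀ {j : Fin 4} (_ : j ≠ 1) (_ : j ≠ 3) {p : ℂ}, p ∈ R.arc j →
      ∃ z : ℂ, (z.re = 0 ∨ z.re = a) ∧ z.im ∈ Icc 0 b ∧ Ψ z = p := by
    intro j hj1 hj3 p hp
    have hpf : p ∈ frontier R.carrier := R.arc_subset_frontier j hp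
    have hpc : p ∈ closure R.carrier := frontier_subset_closure hpf
    rw [← himg] at hpc
    obtain ⟨z, hz, rfl⟩ := hpc
    rw [mem_reProdIm] at hz
    refine ⟨z, ?_, hz.2, rfl⟩
    rcases hz.1.1.eq_or_lt with h0 | h0
    · exact Or.inl h0.symm
    rcases hz.1.2.lt_or_eq with h1 | h1
    swap
    · exact Or.inr h1
    exfalso
    -- `0 < re z < a`: bottom, top or interior
    rcases hz.2.1.eq_or_lt with h2 | h2
    · have : Ψ z ∈ openArc R 1 := hB ⟨z, by rw [mem_reProdIm]; exact ⟨⟨h0, h1⟩, h2.symm⟩, rfl⟩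
      exact Set.disjoint_left.1 (openArc_disjoint_arc R hj1) this hp
    rcases hz.2.2.lt_or_eq with h3 | h3
    · have : Ψ z ∈ R.carrier := by
        rw [← himgo]; exact ⟨z, by rw [mem_reProdIm]; exact ⟨⟨h0, h1⟩, h2, h3⟩, rfl⟩
      exact Set.disjoint_left.1 R.disjoint_carrier_frontier this hpf
    · have : Ψ z ∈ openArc R 3 := hT ⟨z, by rw [mem_reProdIm]; exact ⟨⟨h0, h1⟩, h3⟩, rfl⟩
      exact Set.disjoint_left.1 (openArc_disjoint_arc R hj3) this hp
  constructor
  · refine hL.antisymm fun p hp => ?_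
    obtain ⟨z, hre, him, rfl⟩ := key hjL1 hjL3 hp
    rcases hre with hre | hre
    · exact ⟨z, by rw [mem_reProdIm]; exact ⟨hre, him⟩, rfl⟩
    · have : Ψ z ∈ R.arc jR := hR ⟨z, by rw [mem_reProdIm]; exact ⟨hre, him⟩, rfl⟩
      exact (Set.disjoint_left.1 hdisj02 hp this).elim
  · refine hR.antisymm fun p hp => ?_
    obtain ⟨z, hre, him, rfl⟩ := key hjR1 hjR3 hp
    rcases hre with hre | hre
    · have : Ψ z ∈ R.arc jL := hL ⟨z, by rw [mem_reProdIm]; exact ⟨hre, him⟩, rfl⟩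
      exact (Set.disjoint_left.1 hdisj02 this hp).elim
    · exact ⟨z, by rw [mem_reProdIm]; exact ⟨hre, him⟩, rfl⟩

/-- **The extremal distance between the arcs `(ab)`, `(cd)` of a conformal rectangle is the
aspect ratio `a/b` of a uniformizing rectangle whose closed vertical sides go onto these arcs**
(conformal invariance of the extremal distance under the uniformizer, which is a homeomorphism of
the closures — `extremalDistance_image_eq` — and the rectangle `extremalDistance_rectangle`).
[cite: Ahlfors1973CI, §4-2 p. 53] -/
theorem extremalDistance_arc_eq (R : ConformalRectangle) {a b : ℝ} (ha : 0 < a) (hb : 0 < b)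
    {Ψ : ℂ → ℂ} {jL jR : Fin 4} (hc : ContinuousOn Ψ (Icc 0 a ×ℂ Icc 0 b))
    (hinj : InjOn Ψ (Icc 0 a ×ℂ Icc 0 b)) (himg : Ψ '' (Icc 0 a ×ℂ Icc 0 b) = closure R.carrier)
    (himgo : Ψ '' (Ioo 0 a ×ℂ Ioo 0 b) = R.carrier) (hdiff : DifferentiableOn ℂ Ψ (Ioo 0 a ×ℂ Ioo 0 b))
    (hderiv : ∀ z ∈ Ioo 0 a ×ℂ Ioo 0 b, deriv Ψ z ≠ 0) (hLR : (jL = 0 ∧ jR = 2) ∨ (jL = 2 ∧ jR = 0))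
    (hLeq : Ψ '' ({0} ×ℂ Icc 0 b) = R.arc jL) (hReq : Ψ '' ({a} ×ℂ Icc 0 b) = R.arc jR) :
    Literature.Analysis.Complex.extremalDistance R.carrier (R.arc 0) (R.arc 2) = ENNReal.ofReal (a / b) := by
  have hopen : IsOpen (Ioo 0 a ×ℂ Ioo (0 : ℝ) b) := isOpen_Ioo.reProdIm isOpen_Ioo
  have hcl : closure (Ioo 0 a ×ℂ Ioo (0 : ℝ) b) = Icc 0 a ×ℂ Icc 0 b := by
    rw [closure_reProdIm, closure_Ioo ha.ne, closure_Ioo hb.ne]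
  have hcpt : IsCompact (Icc 0 a ×ℂ Icc (0 : ℝ) b) := isCompact_Icc.reProdIm isCompact_Icc
  set g : ℂ → ℂ := Function.invFunOn Ψ (Icc 0 a ×ℂ Icc 0 b) with hg
  have hgf : ∀ z ∈ closure (Ioo 0 a ×ℂ Ioo (0 : ℝ) b), g (Ψ z) = z := fun z hz =>
    hinj.leftInvOn_invFunOn (by rwa [hcl] at hz)
  have hgc : ContinuousOn g (closure R.carrier) := by
    rw [← himg]
    exact Literature.Probability.RandomPlanarGeometry.IsCompact.continuousOn_invFunOn hcpt hc hinj
  have hgd : DifferentiableOn ℂ g R.carrier := by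
    rw [← himgo]
    have h1 := Complex.differentiableOn_invFunOn_image hopen hdiff
      (hinj.mono (by rw [← hcl]; exact subset_closure)) hderiv
    refine h1.congr fun p hp => ?_
    obtain ⟨z, hz, rfl⟩ := hp
    have hz' : z ∈ Icc 0 a ×ℂ Icc (0 : ℝ) b := by rw [← hcl]; exact subset_closure hz
    have hex : ∃ w ∈ Ioo 0 a ×ℂ Ioo (0 : ℝ) b, Ψ w = Ψ z := ⟨z, hz, rfl⟩
    have hm := Function.invFunOn_mem hex
    have heq := Function.invFunOn_eq hex
    rw [hgf z (subset_closure hz)]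
    exact (hinj (by rw [← hcl]; exact subset_closure hm) hz' heq).symm
  have key := Literature.Analysis.Complex.extremalDistance_image_eq (E₁ := {0} ×ℂ Icc 0 b)
    (E₂ := {a} ×ℂ Icc 0 b) hopen R.isOpen hdiff hgd (by rwa [hcl]) hgc himgo hgf
    (by rw [hcl]; intro z hz; rw [mem_reProdIm] at hz ⊢; simp only [mem_singleton_iff] at hz
        exact ⟨by rw [hz.1]; exact ⟨le_rfl, ha.le⟩, hz.2⟩)
    (by rw [hcl]; intro z hz; rw [mem_reProdIm] at hz ⊢; simp only [mem_singleton_iff] at hz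
        exact ⟨by rw [hz.1]; exact ⟨ha.le, le_rfl⟩, hz.2⟩)
  rw [Literature.Analysis.Complex.extremalDistance_rectangle ha hb, hLeq, hReq] at key
  rcases hLR with ⟨rfl, rfl⟩ | ⟨rfl, rfl⟩
  · exact key
  · rw [Literature.Analysis.Complex.extremalDistance_comm]; exact key

/-! ### §5. The identification -/

/-- **The extremal distance between the arcs of a conformal rectangle and the cross-ratio.**
For every conformal rectangle `R` there is `r > 0` (the aspect ratio `2K(k²)/K(1-k²)` of its
uniformizing rectangle) with `d_Ω((ab), (cd)) = r` and, for every uniformizing datum `(φ, x)`,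
`₂F₁(½,½;1;η)/₂F₁(½,½;1;1-η) = r⁻¹`, `η = crossRatio x`: the reciprocal extremal distance between
`(ab)` and `(cd)` is `K(η)/K(1-η)` (Bollobás–Riordan (2006), p. 185; Ahlfors (1973), §4-2).
[cite: BollobasRiordan2006, Ch. 7 §7.1 p. 185] -/
theorem exists_extremalDistance_arc_eq (R : ConformalRectangle) :
    ∃ r : ℝ, 0 < r ∧
      Literature.Analysis.Complex.extremalDistance R.carrier (R.arc 0) (R.arc 2) = ENNReal.ofReal r ∧
      ∀ (φ : ConformalEquiv upperHalfPlaneSet R.carrier) (x : Fin 4 → ℝ), R.IsUniformizing φ x →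
        ordinaryHypergeometric (1 / 2 : ℝ) (1 / 2) 1 (crossRatio x) /
            ordinaryHypergeometric (1 / 2 : ℝ) (1 / 2) 1 (1 - crossRatio x) = r⁻¹ := by
  obtain ⟨k, hk0, hk1, Ψ, jL, jR, hcr, hc, hinj, himg, himgo, hdiff, hderiv, hLR, hL, hR, hLo, hRo, hB, hT⟩ :=
    exists_rect_uniformizer_modulus R
  have hKp : 0 < ellipticK (k ^ 2) := ellipticK_sq_pos hk0 hk1
  have hK'p : 0 < ellipticK (1 - k ^ 2) := ellipticK_one_sub_sq_pos hk0 hk1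
  have ha : 0 < 2 * ellipticK (k ^ 2) := by positivity
  obtain ⟨hLeq, hReq⟩ := image_sides_eq R himg himgo hLR hL hR hB hT
  refine ⟨2 * ellipticK (k ^ 2) / ellipticK (1 - k ^ 2), div_pos ha hK'p,
    extremalDistance_arc_eq R ha hK'p hc hinj himg himgo hdiff hderiv hLR hLeq hReq, fun φ x h => ?_⟩
  rw [hcr φ x h, hypergeometric_ratio_eq hk0 hk1, inv_div]

/-- **`d_Ω((ab),(cd))⁻¹ = ₂F₁(½,½;1;η)/₂F₁(½,½;1;1-η)`** for every uniformizing datum with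
cross-ratio `η` (the form used by `KirchhoffExtremalLength`: the target of the Kirchhoff slope,
the effective conductance between the discrete arcs, is the reciprocal extremal distance).
[cite: BollobasRiordan2006, Ch. 7 §7.1 p. 185] -/
theorem toReal_inv_extremalDistance_arc_eq (R : ConformalRectangle)
    {φ : ConformalEquiv upperHalfPlaneSet R.carrier} {x : Fin 4 → ℝ} (h : R.IsUniformizing φ x) :
    ((Literature.Analysis.Complex.extremalDistance R.carrier (R.arc 0) (R.arc 2))⁻¹).toReal =
      ordinaryHypergeometric (1 / 2 : ℝ) (1 / 2) 1 (crossRatio x) /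
        ordinaryHypergeometric (1 / 2 : ℝ) (1 / 2) 1 (1 - crossRatio x) := by
  obtain ⟨r, hr, hd, hF⟩ := exists_extremalDistance_arc_eq R
  rw [hF φ x h, hd, ← ENNReal.ofReal_inv_of_pos hr, ENNReal.toReal_ofReal (inv_pos.2 hr).le]

end ModulusIdentification

end Summit.CriticalPhenomena.CardyFormulaZ2.Theorems
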